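import Summits.NavierStokesRegularity.NavierStokesRegularity.Theses.QuantisedSymmetry
import Summits.NavierStokesRegularity.NavierStokesRegularity.Theses.Blowup
import Summits.NavierStokesRegularity.NavierStokesRegularity.Theorems.QuantisedSymmetryPolyhedralTruncationBridge
import Summits.NavierStokesRegularity.NavierStokesRegularity.Theorems.QuantisedSymmetryLiouvilleKillsProfile
import Summits.NavierStokesRegularity.NavierStokesRegularity.Theorems.QuantisedSymmetryPolyhedralDssProfileExistsOfCell
import Summits.NavierStokesRegularity.NavierStokesRegularity.Theorems.QuantisedSymmetryPolyhedralDssProfileExistsCellOfProfile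
import Summits.NavierStokesRegularity.NavierStokesRegularity.Theorems.QuantisedSymmetryPolyhedralDssProfileExistsDominatesBlowupProfile
import Literature.Analysis.FluidPDE.SelfSimilar
import HarnessLib

/-!
# Strategist census s14 (gen 9) — typed signatures for crux `PolyhedralDssProfileExists`
  (stmt-NavierStokesRegularity-1404, route QuantisedSymmetry)

Companion to `Cruxes/PolyhedralDssProfileExists/STRATEGY-CENSUS-s14.md`. Every `def` below is one
candidate of the census (weaker intermediate / strengthening / decomposition piece / negation
target); every `theorem` is a CHECKED relation between candidates and the crux `X` or the summit.
Nothing here is a registered line: the census verdict is `no-strategy-short-of-summit`, and this file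
is the evidence that each typed attempt either (i) still decides the summit, or (ii) has one piece
that is the crux again modulo a provable lemma.
-/

noncomputable section

set_option linter.dupNamespace false

namespace Summit.NavierStokesRegularity.NavierStokesRegularity.Cruxes.PolyhedralDssProfileExists.StrategistS14

open MeasureTheory Set Function
open Literature.Analysis.FluidPDE
open Summit.NavierStokesRegularity.NavierStokesRegularity

local notation "E3" => EuclideanSpace ℝ (Fin 3)

/-- The crux. -/
abbrev X : Prop := Theses.QuantisedSymmetry.PolyhedralDssProfileExists

/-! ## 0. Summit strength: `X` alone decides the Millennium statement (negatively) — in tree. -/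

/-- `X → ¬ NavierStokesRegularity`: the route's deciding theorem with its two other hypotheses
discharged by tree theorems (`quantisedSymmetry_polyhedralTruncationBridge_proof`, stmt-11331;
`ClayUniqueness_holds`, stmt-0153). So any statement implying `X` is at least summit-strength. -/
theorem X_decides_summit : X → ¬ _root_.NavierStokesRegularity := fun hX =>
  Theses.QuantisedSymmetry.closes hX Theorems.quantisedSymmetry_polyhedralTruncationBridge_proof
    Theses.QuantisedSymmetry.ClayUniqueness_holds

/-! ## 1. Weaker intermediate: the sector-free rotated-DSS Type-I profile (the G-clauses dropped). -/

/-- W: a nontrivial Type-I rotated-`λ`-DSS ancient mild profile exists (no symmetry group). This is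
literally the hypothesis of the PROVED bridge `FilamentSkeletonRss.RdssProfileTruncation`
(stmt-11289) and, up to pushing a negation, `Blowup.BlowupTypeIDssProfile` (stmt-0155). -/
def RdssTypeIProfileExists : Prop :=
  ∃ (c : ℝ) (R : E3 ≃ₗᵢ[ℝ] E3) (u : ℝ → E3 → E3), 1 < c ∧ IsAncientMildSolution 1 u ∧
    (∀ t < 0, AEStronglyMeasurable (u t) volume) ∧ IsRotatedDSS c R u ∧
    (∃ C₀ : ℝ, HasTypeIDecay C₀ u) ∧ ¬ (∀ t < 0, u t =ᵐ[volume] 0)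

/-- `X → W` (take `R = 1`). -/
theorem rdss_of_X : X → RdssTypeIProfileExists := by
  rintro ⟨G, -, -, -, c, hc, u, hanc, hmeas, hdss, hdec, -, hnt⟩
  exact ⟨c, LinearIsometryEquiv.refl ℝ E3, u, hc, hanc, hmeas, isRotatedDSS_refl_iff.mpr hdss, hdec, hnt⟩

/-- `X → stmt-0155` (in tree, `stub_dominatesBlowupProfile`). -/
theorem blowupProfile_of_X : X → Theses.Blowup.BlowupTypeIDssProfile :=
  Theorems.PolyhedralDssProfileExists.PolyhedralCell.stub_dominatesBlowupProfile

/-- **The weaker intermediate STILL decides the summit**: `W → ¬ NavierStokesRegularity`, by the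
proved sector-free truncation bridge (stmt-11289) and the Blowup route's deciding theorem with
`BlowupClayUniqueness` proved (stmt-0153). Replacing `X` by `W` therefore does not produce a
statement short of the summit; it merges this route into Blowup / DssFarFieldSlaving (#5, rank 5). -/
theorem rdss_decides_summit : RdssTypeIProfileExists → ¬ _root_.NavierStokesRegularity := fun hW =>
  Theses.Blowup.closes (Theorems.filamentSkeletonRss_rdssProfileTruncation_proof hW)
    Theses.Blowup.BlowupClayUniqueness_holds

/-! ## 2. Cells: the crux is the existence of ONE polyhedral cell (in tree, `polyhedralDssProfileExists_iff_cell`). -/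

/-- The clauses of a `G`-cell with factor `c` on the model period `[-1, -c⁻²]`, with the junction
condition relaxed to a defect `≤ ε` (ε = 0 is the exact cell). -/
def IsApproxCell (G : Subgroup (E3 ≃ₗᵢ[ℝ] E3)) (c ε : ℝ) (v : ℝ → E3 → E3) : Prop :=
  ContinuousOn (Function.uncurry v) (Set.Icc (-1 : ℝ) (-(c ^ 2)⁻¹) ×ˢ Set.univ) ∧
  (∃ M : ℝ, ∀ t ∈ Set.Icc (-1 : ℝ) (-(c ^ 2)⁻¹), ∀ x, ‖v t x‖ ≤ M) ∧
  (∀ t ∈ Set.Icc (-1 : ℝ) (-(c ^ 2)⁻¹), IsWeaklyDivFree (v t)) ∧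
  (∀ s t : ℝ, -1 ≤ s → s < t → t ≤ -(c ^ 2)⁻¹ → ∀ x,
    v t x = heatFlow (v s) (t - s) x - oseenDuhamel 1 s v v t x) ∧
  (∀ x, ‖v (-(c ^ 2)⁻¹) x - c • v (-1) (c • x)‖ ≤ ε) ∧
  (∀ g ∈ G, ∀ t ∈ Set.Icc (-1 : ℝ) (-(c ^ 2)⁻¹), ∀ x, v t (g x) = g (v t x))

/-- The polyhedral-group clauses. -/
def IsPolyhedralGroup (G : Subgroup (E3 ≃ₗᵢ[ℝ] E3)) : Prop :=
  Finite G ∧ (∀ g ∈ G, LinearMap.det (g.toLinearEquiv : E3 →ₗ[ℝ] E3) = 1) ∧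
  (∀ V : Submodule ℝ E3, (∀ g ∈ G, ∀ v ∈ V, g v ∈ V) → V = ⊥ ∨ V = ⊤)

/-- Exact polyhedral cell with nontrivial `L⁴` datum (= the registered stub `stub_polyhedralCellExists`,
written with `IsApproxCell … 0`). -/
def PolyhedralCellExists : Prop :=
  ∃ G : Subgroup (E3 ≃ₗᵢ[ℝ] E3), IsPolyhedralGroup G ∧ ∃ c : ℝ, 1 < c ∧ ∃ v : ℝ → E3 → E3,
    IsApproxCell G c 0 v ∧ MemLp (v (-1)) 4 volume ∧ ¬ (v (-1) =ᵐ[volume] 0)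

/-- An `ε = 0` approximate cell is an exact cell (junction by `norm_le_zero_iff`). -/
theorem exact_of_approxCell_zero {G : Subgroup (E3 ≃ₗᵢ[ℝ] E3)} {c : ℝ} {v : ℝ → E3 → E3}
    (h : IsApproxCell G c 0 v) :
    ContinuousOn (Function.uncurry v) (Set.Icc (-1 : ℝ) (-(c ^ 2)⁻¹) ×ˢ Set.univ) ∧
    (∃ M : ℝ, ∀ t ∈ Set.Icc (-1 : ℝ) (-(c ^ 2)⁻¹), ∀ x, ‖v t x‖ ≤ M) ∧
    (∀ t ∈ Set.Icc (-1 : ℝ) (-(c ^ 2)⁻¹), IsWeaklyDivFree (v t)) ∧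
    (∀ s t : ℝ, -1 ≤ s → s < t → t ≤ -(c ^ 2)⁻¹ → ∀ x,
      v t x = heatFlow (v s) (t - s) x - oseenDuhamel 1 s v v t x) ∧
    (∀ x, v (-(c ^ 2)⁻¹) x = c • v (-1) (c • x)) ∧
    (∀ g ∈ G, ∀ t ∈ Set.Icc (-1 : ℝ) (-(c ^ 2)⁻¹), ∀ x, v t (g x) = g (v t x)) := by
  obtain ⟨h1, h2, h3, h4, h5, h6⟩ := h
  refine ⟨h1, h2, h3, h4, fun x => ?_, h6⟩
  exact sub_eq_zero.mp (norm_le_zero_iff.mp (h5 x))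

/-- `PolyhedralCellExists → X` (the landed reduction `stub_profileOfPolyhedralCell`). -/
theorem X_of_cell : PolyhedralCellExists → X := by
  rintro ⟨G, ⟨hfin, hdet, hirr⟩, c, hc, v, hcell, hL4, hnt⟩
  exact Theorems.PolyhedralDssProfileExists.PolyhedralCell.stub_profileOfPolyhedralCell
    ⟨G, hfin, hdet, hirr, c, hc, v, exact_of_approxCell_zero hcell, hL4, hnt⟩

/-- `X → PolyhedralCellExists` (the landed `stub_cellOfProfile`; junction defect `0 ≤ 0`). -/
theorem cell_of_X : X → PolyhedralCellExists := by
  intro hX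
  obtain ⟨G, hfin, hdet, hirr, c, hc, v, ⟨h1, h2, h3, h4, h5, h6⟩, hL4, hnt⟩ :=
    Theorems.PolyhedralDssProfileExists.PolyhedralCell.stub_cellOfProfile hX
  refine ⟨G, ⟨hfin, hdet, hirr⟩, c, hc, v, ⟨h1, h2, h3, h4, fun x => ?_, h6⟩, hL4, hnt⟩
  rw [h5 x, sub_self, norm_zero]

/-! ## 3. Strengthen: robust (structurally stable in the factor) cells — an S⁺ that buys nothing here. -/

/-- S⁺: for some polyhedral `G`, exact nontrivial `L⁴` cells exist for EVERY factor in an open interval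
`(a, b)`, `1 < a < b` — the typable shadow of "a non-degenerate fixed point of `𝓡_G = 𝒮_λ⁻¹ ∘ Φ_NS`"
(IFT ⇒ persistence in `λ`). -/
def RobustPolyhedralCells : Prop :=
  ∃ G : Subgroup (E3 ≃ₗᵢ[ℝ] E3), IsPolyhedralGroup G ∧ ∃ a b : ℝ, 1 < a ∧ a < b ∧
    ∀ c ∈ Set.Ioo a b, ∃ v : ℝ → E3 → E3,
      IsApproxCell G c 0 v ∧ MemLp (v (-1)) 4 volume ∧ ¬ (v (-1) =ᵐ[volume] 0)

/-- `S⁺ → X` (pick the midpoint factor). The added rigidity is a property of a solution nobody has;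
it does not supply one. -/
theorem X_of_robust : RobustPolyhedralCells → X := by
  rintro ⟨G, hG, a, b, ha, hab, h⟩
  have hmid : (a + b) / 2 ∈ Set.Ioo a b := ⟨by linarith, by linarith⟩
  obtain ⟨v, hcell, hL4, hnt⟩ := h _ hmid
  exact X_of_cell ⟨G, hG, (a + b) / 2, by linarith, v, hcell, hL4, hnt⟩

/-! ## 4. Decomposition attempts (k = 2, assembly proved) — each has a piece that is the crux again. -/

/-- D1, piece 1: UNIFORMLY Type-I, UNIFORMLY non-small approximate polyhedral cells with junction
defect `→ 0` (what a convergent numerical continuation would certify at each tolerance). -/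
def ApproxPolyhedralCells : Prop :=
  ∃ G : Subgroup (E3 ≃ₗᵢ[ℝ] E3), IsPolyhedralGroup G ∧ ∃ c : ℝ, 1 < c ∧ ∃ C₁ ε₁ R : ℝ, 0 < ε₁ ∧
    ∀ ε > 0, ∃ v : ℝ → E3 → E3, IsApproxCell G c ε v ∧
      (∀ t ∈ Set.Icc (-1 : ℝ) (-(c ^ 2)⁻¹), ∀ x, ‖v t x‖ ≤ C₁ / (‖x‖ + 1)) ∧
      (∃ x : E3, ‖x‖ ≤ R ∧ ε₁ ≤ ‖v (-1) x‖)

/-- D1, piece 2: compactness upgrade (uniform Type-I bound ⇒ `C_loc` compactness of the slab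
solutions by parabolic regularity; junction transfers equicontinuity to the initial slice; the floor
pins nontriviality; the uniform `C₁/(‖x‖+1)` tail gives `v(-1) ∈ L⁴`). Provable-grade (L-sized). -/
def CompactnessUpgrade : Prop := ApproxPolyhedralCells → PolyhedralCellExists

/-- D1 assembly (proved): piece 1 → piece 2 → X. -/
theorem X_of_D1 (h₁ : ApproxPolyhedralCells) (h₂ : CompactnessUpgrade) : X := X_of_cell (h₂ h₁)

/-- D2 (bridge through the negated polyhedral Liouville theorem), piece 1: `¬ #3`. Not summit-deciding
(a non-DSS Type-I ancient `G`-flow feeds no truncation bridge), believed FALSE (KNSS (L)). -/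
def NotPolyhedralLiouville : Prop := ¬ Theses.QuantisedSymmetry.PolyhedralTypeILiouville

/-- D2, piece 2: dynamical selection — some nontrivial `G`-equivariant Type-I ancient flow ⇒ a
DISCRETELY SELF-SIMILAR one (a periodic orbit of the similarity-variable flow). -/
def DssSelection : Prop := ¬ Theses.QuantisedSymmetry.PolyhedralTypeILiouville → X

/-- D2 assembly (proved, modus ponens). -/
theorem X_of_D2 (h₁ : NotPolyhedralLiouville) (h₂ : DssSelection) : X := h₂ h₁

/-- D2 is vacuous as a plan: the only road to piece 2 in sight is #3 itself, which REFUTES piece 1. -/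
theorem D2_piece2_of_liouville (hL : Theses.QuantisedSymmetry.PolyhedralTypeILiouville) :
    DssSelection := fun h => absurd hL h

theorem D2_piece1_false_of_liouville (hL : Theses.QuantisedSymmetry.PolyhedralTypeILiouville) :
    ¬ NotPolyhedralLiouville := fun h => h hL

/-! ## 5. Negation: `¬X` is exactly what the route's kill switch #3 delivers (stmt-1408, in tree). -/

/-- `#3 → ¬X` (tree theorem `quantisedSymmetry_liouvilleKillsProfile_proof`). The negation side of the
crux is already a ranked route item (stmt-1405); nothing new to file. -/
theorem notX_of_liouville : Theses.QuantisedSymmetry.PolyhedralTypeILiouville → ¬ X := fun hL hX =>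
  Theorems.quantisedSymmetry_liouvilleKillsProfile_proof hL hX

end Summit.NavierStokesRegularity.NavierStokesRegularity.Cruxes.PolyhedralDssProfileExists.StrategistS14

end
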